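import Summits.ResolutionOfSingularities.ResolutionOfSingularities.Theorems.HilbertSamuelEliminationSigmaMaxModificationsCorridor3WLadderForcedGameTowersDefs
import Literature.AlgebraicGeometry.Resolution.SymbolicPowersMonomialVeronese
import HarnessLib

/-!
# [OURS · L1 W4.2] CARD C4 «FORCED HIRONAKA GAME AT ISOLATED VERTICES» — the ALGEBRA: P2 and T2 (algebraic form) PROVED
# (cell res-hironaka, LADDER-RESOLUTION rung L; slot W4.2, crux chain w42 `SigmaMaxModificationsCorridor3`
# stmt-ResolutionOfSingularities-19249; `--supports stmt-ResolutionOfSingularities-19249 --as helper`; W4.2 DEAL object D5)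

What is proved here (res-D-pv-010, object D5 «C4 ALGEBRA» of res-L1-w42-plan-1's W4.2 DEAL 2026-08-27T07:34:07Z), BY NAME
against the definitions of res-L1-w42-idea-1's card C4 §1–§2 (`L/res-L1-w42-idea-1/Sketch-L1-idea-1-C4.lean` sha16
`08c84fc33d6000e7`) as landed by res-type-012 in `…Corridor3WLadderForcedGameTowersDefs.lean` (W4.2 DEAL D2; namespace
`…Cruxes.SigmaMaxModifications.IdeasL1C4`, reused here so that everything composes by short name; the printed game vocabulary
`IsPosition`/`IsPermissible`/`Won`/`gameMove`/`play`/`PositionalWin` is res-type-004's `Literature/Combinatorics/HironakaPolyhedraGame/Spivakovsky1983.lean`,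
W4.2 DEAL D4, imported BY NAME through D2):

* **P2 `pairConditionOfAlgIsolated : PairConditionOfAlgIsolated`** — ALGEBRAIC ISOLATION ⇒ PAIR CONDITION: for a monic
  `h ∈ S[X]` of degree `m` over a noetherian local `S` with a frame `u` (non-zero-divisor clause `H`, `u ⊆ 𝔪_S`), if no
  coordinate curve ideal satisfies `h ∈ (X, u_a, u_b)^m` then for every pair `a ≠ b` some generating point of `Δ(h; u; X)` has
  `x_a + x_b < 1`.  Proof: contrapositive — if every generating point `c/i` (`c ∈ 𝐒(h_{m−i})`, Cossart–Piltant Prop. 2.1, tree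
  `CossartPiltant.minExponents_spec'`) has `c_a + c_b ≥ i`, then `u^c ∈ (u_a, u_b)^{c_a + c_b} ⊆ (u_a, u_b)^i` (tree
  `uPow_mem_pow_span_image`), so `h_{m−i} ∈ (u_a, u_b)^i` and `h = X^m + Σ h_{m−i} X^{m−i} ∈ (X, u_a, u_b)^m`
  (`Polynomial.Monic.as_sum`).
* **T2, algebraic form: `isoVertexChainImpossible_of_forcedGameTerminates : ForcedGameTerminates 3 → IsoVertexChainImpossible`**
  — an origin-chart chain (Cossart–Piltant Prop. 2.6 hypotheses with `J = univ`) all of whose characteristic polyhedra are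
  iso-admissible sandwiches an infinite forced play.  Steps: `genPoints_originChart` — by the tree's PROVED
  `CossartPiltant.minExponents_of_mul_pow_eq`, `genPoints u' h' ⊆ σ_{univ,j₀}(genPoints u h)` and every point of
  `σ_{univ,j₀}(genPoints u h)` dominates a point of `genPoints u' h'` (the exponent law `a' = l₀(a) − i e_{j₀}` divided by `i` IS
  the forced move, `cast_div_update_sub_eq_forcedMove`; the needed `i ≤ |a|` is the admissibility clause `|x| > 1`);
  `isIsoAdmissible_of_sandwich` — iso-admissibility passes UP a domination sandwich `G ⊆ A`, `∀ a ∈ A ∃ g ∈ G, g ≤ a`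
  (`forcedMove_mono`); the forced play `A_{n+1} = σ_{univ,j₀(n)}(A_n)` from `A_0 = genPoints (u 0) (h 0)` (by `Nat.rec`) then
  sandwiches `genPoints (u n) (h n)` for every `n`, contradicting `ForcedGameTerminates 3`.

So, together with res-type-012's `…ForcedGameTowers.lean` (idea-1's proved assemblies), C4's T2 `IsoVertexTowersImpossible` stands
modulo exactly {Spivakovsky's printed theorem (`PositionalWin 3`, the Literature named fact `Spivakovsky1983_winningStrategy` of
W4.2 DEAL D4), P1
`AlgIsolatedOfIsolated` (retyped with frame/excellence binders, res-D-pv-010 FINDING #2 07:31:04Z)}; the residual core is T3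
`IsoTranslationTowersImpossible p`. Everything here is OURS and elementary (finite sets of rational points; `Polynomial`/`Ideal`
algebra; the tree's PROVED Cossart–Piltant API `minExponents_spec'` / `minExponents_of_mul_pow_eq` / `uPow`); no scheme, no
named fact, never a `Theses/…` import; NOT a statement of Hironaka's manuscript [Hironaka2017] nor of CJS LNM 2270. Context only
(nothing used as a premise): V. Cossart, O. Piltant, J. Algebra 529 (2019) Prop. 2.1, Prop. 2.6; M. Spivakovsky, «A solution to
Hironaka's polyhedra game», Progr. Math. 36 (1983). AI-written; no expert review; AI review is weaker than expert review.
-/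

set_option linter.dupNamespace false
set_option autoImplicit false

noncomputable section

open Polynomial Finset
open scoped BigOperators

namespace Summit.ResolutionOfSingularities.ResolutionOfSingularities.Cruxes.SigmaMaxModifications.IdeasL1C4

open Summit.ResolutionOfSingularities.ResolutionOfSingularities.Theorems.SigmaMaxModificationsCorridor3.ShadowM
open Literature.AlgebraicGeometry.Resolution Literature.AlgebraicGeometry.Resolution.CossartPiltant
open Literature.Combinatorics.HironakaPolyhedraGame

variable {d : ℕ}

/-! ## P2 — algebraic isolation ⇒ pair condition -/

/-- **P2 (card C4)**: if no coordinate curve ideal satisfies `h ∈ (X, u_a, u_b)^m`, then for every pair `a ≠ b` some generating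
point of `Δ(h; u; X)` has `x_a + x_b < 1` (contrapositive: `c_a + c_b ≥ i` on `𝐒(h_{m−i})` for all `i` puts `h_{m−i}` in
`(u_a,u_b)^i` and `h` in `(X,u_a,u_b)^m`). [OURS] -/
theorem pairConditionOfAlgIsolated : PairConditionOfAlgIsolated := by
  intro S _ _ _ u h H hu hmon hiso a b hab
  classical
  by_contra hcon
  push Not at hcon
  apply hiso a b hab
  set m := h.natDegree with hm
  set I : Ideal S[X] := Ideal.span ({X, C (u a), C (u b)} : Set S[X]) with hI
  set T : Finset (Fin 3) := {a, b} with hT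
  set P : Ideal S := Ideal.span (u '' ↑T) with hP
  have hXI : (X : S[X]) ∈ I := Ideal.subset_span (by simp)
  have hPI : P.map (C : S →+* S[X]) ≤ I := by
    rw [Ideal.map_le_iff_le_comap, hP, Ideal.span_le]
    rintro _ ⟨j, hj, rfl⟩
    have hj' : j = a ∨ j = b := by simpa [hT] using hj
    rw [SetLike.mem_coe, Ideal.mem_comap]
    rcases hj' with rfl | rfl
    · exact Ideal.subset_span (by simp)
    · exact Ideal.subset_span (by simp)
  -- the lower coefficients
  have hcoef : ∀ i ∈ Finset.Icc 1 m, h.coeff (m - i) ∈ P ^ i := by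
    intro i hi
    obtain ⟨-, hf, -⟩ := minExponents_spec' u H hu (h.coeff (m - i))
    refine (show Ideal.span _ ≤ P ^ i from ?_) hf
    rw [span_uPow_le_iff]
    intro c hc
    have hg : (fun j => (c j : ℚ) / (i : ℚ)) ∈ genPoints u h := by
      simp only [genPoints, Finset.mem_biUnion, Finset.mem_image]
      exact ⟨i, hi, c, Finset.mem_coe.mp hc, rfl⟩
    have h1 := hcon _ hg
    have hi1 : 1 ≤ i := (Finset.mem_Icc.mp hi).1
    have hipos : (0 : ℚ) < i := by exact_mod_cast hi1
    have hle : i ≤ c a + c b := by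
      have h2 : (1 : ℚ) ≤ ((c a : ℚ) + c b) / i := by rwa [add_div]
      rw [le_div_iff₀ hipos, one_mul] at h2
      exact_mod_cast h2
    have hsum : ∑ j ∈ T, c j = c a + c b := Finset.sum_pair hab
    exact Ideal.pow_le_pow_right (hsum ▸ hle) (uPow_mem_pow_span_image u T c)
  -- assemble
  rw [hmon.as_sum]
  refine Ideal.add_mem _ (Ideal.pow_mem_pow hXI m) (Ideal.sum_mem _ fun n hn => ?_)
  have hn' : n < m := Finset.mem_range.mp hn
  have hi : m - n ∈ Finset.Icc 1 m := Finset.mem_Icc.mpr ⟨by omega, by omega⟩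
  have hc : C (h.coeff n) ∈ I ^ (m - n) := by
    have := hcoef (m - n) hi
    rw [show m - (m - n) = n by omega] at this
    have hmap : C (h.coeff n) ∈ (P ^ (m - n)).map (C : S →+* S[X]) := Ideal.mem_map_of_mem _ this
    rw [Ideal.map_pow] at hmap
    exact Ideal.pow_right_mono hPI _ hmap
  have := Ideal.mul_mem_mul hc (Ideal.pow_mem_pow hXI n)
  rwa [← pow_add, show m - n + n = m by omega] at this


/-! ## T2 (algebraic form) — `ForcedGameTerminates 3 → IsoVertexChainImpossible` -/

/-- The forced move `σ_{univ,i}` is monotone for the coordinatewise order. [OURS] -/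
theorem forcedMove_mono (i : Fin d) {x y : Fin d → ℚ} (hxy : x ≤ y) : forcedMove i x ≤ forcedMove i y := by
  intro j
  simp only [forcedMove, gameMove]
  split_ifs
  · exact sub_le_sub_right (Finset.sum_le_sum fun k _ => hxy k) 1
  · exact hxy j

/-- Iso-admissibility passes UP a domination sandwich: `G ⊆ A` and every point of `A` dominates a point of `G`
(positivity, `|x| > 1` and non-permissibility of proper `Γ` are all monotone in this sense). [OURS] -/
theorem isIsoAdmissible_of_sandwich {G A : Finset (Fin d → ℚ)} (hGA : G ⊆ A)
    (hdom : ∀ a ∈ A, ∃ g ∈ G, g ≤ a) (hG : IsIsoAdmissible G) : IsIsoAdmissible A := by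
  obtain ⟨⟨hne, hnn⟩, hδ, hperm⟩ := hG
  refine ⟨⟨hne.mono hGA, fun a ha j => ?_⟩, fun a ha => ?_, fun Γ hΓ hΓu hp => ?_⟩
  · obtain ⟨g, hg, hga⟩ := hdom a ha
    exact (hnn g hg j).trans (hga j)
  · obtain ⟨g, hg, hga⟩ := hdom a ha
    exact (hδ g hg).trans_le (Finset.sum_le_sum fun j _ => hga j)
  · exact hperm Γ hΓ hΓu fun g hg => hp g (hGA hg)

/-- The origin-chart exponent law divided by `i` IS the forced move: for `0 < i ≤ |a|`,
`(l₀(a) − i e_{j₀}) / i = σ_{univ,j₀}(a / i)` (Cossart–Piltant Prop. 2.6 with `J = univ`, read on `genPoints`). [OURS] -/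
theorem cast_div_update_sub_eq_forcedMove (a : Fin d → ℕ) (j₀ : Fin d) {i : ℕ} (hi : 0 < i)
    (hia : i ≤ ∑ j, a j) :
    (fun j => ((Function.update a j₀ (∑ j ∈ Finset.univ, a j) - i • Pi.single j₀ 1 : Fin d → ℕ) j : ℚ) /
        (i : ℚ)) = forcedMove j₀ (fun j => (a j : ℚ) / (i : ℚ)) := by
  have hi' : (i : ℚ) ≠ 0 := by exact_mod_cast hi.ne'
  funext j
  simp only [forcedMove, gameMove, Pi.sub_apply, Pi.smul_apply, smul_eq_mul]
  by_cases hj : j = j₀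
  · subst hj
    simp only [Function.update_self, Pi.single_eq_same, mul_one, if_true]
    rw [Nat.cast_sub hia, Nat.cast_sum, sub_div, ← Finset.sum_div, div_self hi']
  · simp [hj]

/-- **ONE ORIGIN-CHART STEP ON THE GENERATING POINTS** (Cossart–Piltant Prop. 2.6 read through `genPoints`): if every
generating point of `Δ(h; u; X)` has `|x| > 1`, then `genPoints u' h' ⊆ σ_{univ,j₀}(genPoints u h)` and every point of
`σ_{univ,j₀}(genPoints u h)` dominates a point of `genPoints u' h'` — the tree's PROVED `CossartPiltant.minExponents_of_mul_pow_eq`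
coefficient by coefficient; the needed `i ≤ Σ_j a_j` on `𝐒(h_{m−i})` is exactly `|x| > 1` on `genPoints`. [OURS] -/
theorem genPoints_originChart {S : Type} {S' : Type} [CommRing S] [CommRing S'] [IsNoetherianRing S] [IsLocalRing S]
    (ψ : S →+* S') (u : Fin 3 → S) (u' : Fin 3 → S')
    (H : ∀ (i : Fin 3) (T : Finset (Fin 3)), i ∉ T →
      ∀ y, u i * y ∈ Ideal.span (u '' ↑T) → y ∈ Ideal.span (u '' ↑T))
    (hu : ∀ i, u i ∈ IsLocalRing.maximalIdeal S)
    (H' : ∀ (i : Fin 3) (T : Finset (Fin 3)), i ∉ T →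
      ∀ y, u' i * y ∈ Ideal.span (u' '' ↑T) → y ∈ Ideal.span (u' '' ↑T))
    (j₀ : Fin 3) (hnzd : ∀ y : S', u' j₀ * y = 0 → y = 0)
    (hrel : ∀ j, ψ (u j) = if j ∈ (Finset.univ : Finset (Fin 3)) ∧ j ≠ j₀ then u' j₀ * u' j else u' j)
    (hψ : ∀ γ : S, ψ γ ∈ Ideal.span (Set.range u') → γ ∈ Ideal.span (Set.range u))
    (h : S[X]) (h' : S'[X]) (hdeg : h'.natDegree = h.natDegree)
    (hcoef : ∀ i ∈ Finset.Icc 1 h.natDegree,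
      h'.coeff (h.natDegree - i) * u' j₀ ^ i = ψ (h.coeff (h.natDegree - i)))
    (hδ : ∀ g ∈ genPoints u h, (1 : ℚ) < ∑ j, g j) :
    genPoints u' h' ⊆ (genPoints u h).image (forcedMove j₀) ∧
      ∀ g ∈ genPoints u h, ∃ g' ∈ genPoints u' h', g' ≤ forcedMove j₀ g := by
  classical
  -- per coefficient: `i ≤ |a|` on `𝐒(h_{m−i})`
  have hfi : ∀ i ∈ Finset.Icc 1 h.natDegree, ∀ a ∈ minExponents u (h.coeff (h.natDegree - i)),
      i ≤ ∑ j ∈ (Finset.univ : Finset (Fin 3)), a j := by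
    intro i hi a ha
    have hi1 : 1 ≤ i := (Finset.mem_Icc.mp hi).1
    have hipos : (0 : ℚ) < i := by exact_mod_cast hi1
    have hg : (fun j => (a j : ℚ) / (i : ℚ)) ∈ genPoints u h := by
      simp only [genPoints, Finset.mem_biUnion, Finset.mem_image]
      exact ⟨i, hi, a, ha, rfl⟩
    have h1 := hδ _ hg
    have h2 : (1 : ℚ) < (∑ j, (a j : ℚ)) / i := by rwa [Finset.sum_div]
    rw [lt_div_iff₀ hipos, one_mul] at h2
    exact_mod_cast h2.le
  have step := fun i (hi : i ∈ Finset.Icc 1 h.natDegree) =>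
    minExponents_of_mul_pow_eq ψ u u' H hu H' (Finset.mem_univ j₀) hnzd hrel hψ (hfi i hi) (hcoef i hi)
  refine ⟨?_, ?_⟩
  · intro g' hg'
    simp only [genPoints, Finset.mem_biUnion, Finset.mem_image] at hg' ⊢
    obtain ⟨i, hi, a', ha', rfl⟩ := hg'
    rw [hdeg] at hi ha'
    obtain ⟨a, ha, rfl⟩ := (step i hi).1 a' ha'
    have hi1 : 1 ≤ i := (Finset.mem_Icc.mp hi).1
    refine ⟨fun j => (a j : ℚ) / (i : ℚ), ⟨i, hi, a, ha, rfl⟩, ?_⟩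
    rw [← cast_div_update_sub_eq_forcedMove a j₀ hi1 (by simpa using hfi i hi a ha)]
  · intro g hg
    simp only [genPoints, Finset.mem_biUnion, Finset.mem_image] at hg
    obtain ⟨i, hi, a, ha, rfl⟩ := hg
    obtain ⟨a', ha', hle⟩ := (step i hi).2 a ha
    have hi1 : 1 ≤ i := (Finset.mem_Icc.mp hi).1
    have hipos : (0 : ℚ) < i := by exact_mod_cast hi1
    refine ⟨fun j => (a' j : ℚ) / (i : ℚ), ?_, ?_⟩
    · simp only [genPoints, Finset.mem_biUnion, Finset.mem_image]
      exact ⟨i, hdeg ▸ hi, a', hdeg ▸ ha', rfl⟩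
    · rw [← cast_div_update_sub_eq_forcedMove a j₀ hi1 (by simpa using hfi i hi a ha)]
      intro j
      exact div_le_div_of_nonneg_right (Nat.cast_le.mpr (hle j)) hipos.le

/-- **T2, algebraic form (card C4)**: there is no infinite origin-chart chain of hypersurface data all of whose characteristic
polyhedra are iso-admissible, GIVEN that the forced polyhedra game terminates — the forced play
`A_{n+1} = σ_{univ,j₀(n)}(A_n)` from `A_0 = genPoints (u 0) (h 0)` sandwiches `genPoints (u n) (h n)` at every stage
(`genPoints_originChart` + `isIsoAdmissible_of_sandwich` by induction), so it would be an infinite iso-admissible forced play. [OURS] -/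
theorem isoVertexChainImpossible_of_forcedGameTerminates (hF : ForcedGameTerminates 3) :
    IsoVertexChainImpossible := by
  intro S _ _ _ u h j₀ ψ H hu hnzd hrel hψ hdeg hcoef hadm
  classical
  -- the forced play from `genPoints (u 0) (h 0)`
  let A : ℕ → Finset (Fin 3 → ℚ) := fun n =>
    Nat.rec (genPoints (u 0) (h 0)) (fun k B => B.image (forcedMove (j₀ k))) n
  have hA0 : A 0 = genPoints (u 0) (h 0) := rfl
  have hAsucc : ∀ n, A (n + 1) = (A n).image (forcedMove (j₀ n)) := fun n => rfl
  -- the sandwich, by induction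
  have hsand : ∀ n, genPoints (u n) (h n) ⊆ A n ∧ ∀ a ∈ A n, ∃ g ∈ genPoints (u n) (h n), g ≤ a := by
    intro n
    induction n with
    | zero => exact ⟨subset_of_eq hA0.symm, fun a ha => ⟨a, hA0 ▸ ha, le_rfl⟩⟩
    | succ n ih =>
      obtain ⟨hsub, hdom⟩ := ih
      have hst := genPoints_originChart (ψ n) (u n) (u (n + 1)) (H n) (hu n) (H (n + 1)) (j₀ n) (hnzd n)
        (hrel n) (hψ n) (h n) (h (n + 1)) (hdeg n) (hcoef n) (hadm n).2.1
      refine ⟨hst.1.trans (hAsucc n ▸ Finset.image_subset_image hsub), fun a ha => ?_⟩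
      rw [hAsucc, Finset.mem_image] at ha
      obtain ⟨b, hb, rfl⟩ := ha
      obtain ⟨g, hg, hgb⟩ := hdom b hb
      obtain ⟨g', hg', hg'le⟩ := hst.2 g hg
      exact ⟨g', hg', hg'le.trans (forcedMove_mono _ hgb)⟩
  exact hF A j₀ hAsucc fun n => isIsoAdmissible_of_sandwich (hsand n).1 (hsand n).2 (hadm n)


end Summit.ResolutionOfSingularities.ResolutionOfSingularities.Cruxes.SigmaMaxModifications.IdeasL1C4

end
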